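import Summits.BirchSwinnertonDyer.Rank1Residual.X12.CMRamifiedRecordSchemaGTally
import HarnessLib

/-!
# Leaf `CornerF ∧ CMRamified`, slice `p = 3`: PART G addendum — the kernel certificate
# «the recorded generator is NOT `3`-divisible in `E(ℚ)`» (reduction at a small supersingular prime),
# which makes the `t`-bit of a regime-V record generator-independent

HONEST FRAMING (cell `bsd-print-cfram`, run/shared/lean/pub/bsd-print-cfram/, verbatim in every file
of the cell): PARTITION currency only — the leaf counts when its class theorem is in the kernel BY
NAME, flag-free; Literature named facts are statement-only with cite tags, never sorried theorems;
every imported theorem carries its printed hypotheses verbatim; numbers, not adjectives. THIS FILE IS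
DATA INFRASTRUCTURE (computable functions: a point count and the chord–tangent law on `y² = x³ + k`
over `𝔽_p`, a certificate predicate, a record type, a display check, unpacking lemmas, one elementary
group-theory lemma); nothing about any elliptic curve over `ℚ` is asserted, no named fact is
introduced, nothing is booked, no mark moves (regime child V = stmt-BirchSwinnertonDyer-20700 OPEN).

WHY. In the regime-V records (`VRow`, `X12/CMRamifiedRecordSchemaG.lean`; displays PART G / G-B /
G-C) the component bit of a member at the V-prime `ℓ` is read off ONE rational point `G = (X/d², Y/d³)`
(Cremona's / lit's generator); the schema rechecks that `G` is on the curve and recomputes the bit, but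
«`G` generates `E(ℚ)` modulo torsion» is engine content (saturation: PARI ‖ Sage). What the `t`-bit
needs is less: with `E(ℚ) ≅ ℤ` (rank `1`, `#tors = 1` — engines) and the component map
`c_ℓ : E(ℚ) → E(ℚ_ℓ)/E₀(ℚ_ℓ) ≅ ℤ/3`, the image `c_ℓ(E(ℚ))` is `0` iff `c_ℓ(H) = 0` for a generator `H`,
iff `c_ℓ(G) = 0` for ANY `G = mH` with `3 ∤ m`, i.e. for any `G ∉ 3E(ℚ)`. An OFF point (`bit = 1`)
needs nothing (`c_ℓ(G) ≠ 0 ⇒ c_ℓ(E(ℚ)) ≠ 0`); an ON point (`bit = 0`) certifies `c_ℓ(E(ℚ)) = 0` as soon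
as `G ∉ 3E(ℚ)`. So the `tV = 0` records (PART G-C: 27 frames) and the ON image members of the `tV = 1`
records are generator-independent GIVEN a proof that `G ∉ 3E(ℚ)` — this file's certificate
(REF S29 certified the same off-kernel «by explicit supersingular primes»; here it is a `decide`).

THE CERTIFICATE `nonDivThreeCert k X Y d p` (all checks in the kernel): `p` prime (trial division),
`p ≥ 5`, `p ∤ k` (so `y² = x³ + k` has good reduction at `p`: `Δ = −2⁴3³k²`), `p ∤ d`, the reduction
`Ḡ = (X·d̄⁻², Y·d̄⁻³) mod p` lies on the reduced curve, `n := #Ẽ(𝔽_p) = 1 + Σ_{x mod p} #{y : y² = x³ + k}`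
(Euler's criterion per `x`, recomputed — for the primes used, `p ≡ 2 (mod 3)`, this is `p + 1`:
supersingular) is divisible by `3`, and **`(n/3)·Ḡ ≠ O`** in `Ẽ(𝔽_p)` (chord–tangent law mod `p`,
`invMod` by Fermat). MEANING (docstring, not kernel): reduction mod a good prime `p ∤ d` is a group
homomorphism `E(ℚ) ⊂ E(ℚ_p) = E₀(ℚ_p) → Ẽ(𝔽_p)` [cite: SilvermanAEC2009, Prop. VII.2.1], so `G = 3H`
would give `(n/3)·Ḡ = n·H̄ = O` by Lagrange (`nsmul_div_three_of_three_nsmul` below is that step,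
proved) — contradiction. Hence `nonDivThreeCert … = true ⇒ G ∉ 3·E(ℚ)`.

RECORD `SatRow` = (class key, `k`, `G = (X,Y,d)`, `p`, `k'`, `G' = (X',Y',d')`, `p'`) with
`SatRow.ok = nonDivThreeCert` on both members; display check `satCheck rows n` = all ok ∧ `#rows = n`.
Displays: `X12/CMRamifiedVRegimeThreeSat{A,B}.lean` — one row per regime-V record of PART G (20),
G-B (29), G-C (179): 228 frames, 456 certificates, primes used `p ∈ {5, 11, 17, 23, 29, 41, 47}`
(smallest that works; HOME/ty3/partGC/satrows.json, gensat.py = python replica). The coordinates are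
COPIED from the V records (REF byte-compares; `SatRow.matchesV` states the join).
-/

set_option autoImplicit false

namespace Summit.BirchSwinnertonDyer.Rank1Residual.X12.CMRamifiedRecords

open Summit.BirchSwinnertonDyer.BirchSwinnertonDyer.Rank1Residual.HeegnerIndexRecords (isPrimeTD)

/-! ### §1 Arithmetic of `y² = x³ + k` over `𝔽_p` (computable, `p` an odd prime) -/

/-- Number of `y mod p` with `y² ≡ a`: `1` if `a ≡ 0`, `2` if `a` is a non-zero square (Euler's
criterion `a^{(p−1)/2} ≡ 1`), else `0` (`p` an odd prime). [folklore] -/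
def sqrtCountMod (a : ℤ) (p : ℕ) : ℕ :=
  if a % (p : ℤ) = 0 then 1 else if (a % (p : ℤ)) ^ ((p - 1) / 2) % (p : ℤ) = 1 then 2 else 0

/-- `#Ẽ_k(𝔽_p) = 1 + Σ_{x mod p} #{y : y² ≡ x³ + k}` (the point at infinity counted). [folklore] -/
def cardModMordell (k : ℤ) (p : ℕ) : ℕ :=
  ((List.range p).map fun x => sqrtCountMod ((x : ℤ) ^ 3 + k) p).sum + 1

/-- Inverse modulo a prime `p` by Fermat, `a^{p−2} mod p` (junk if `p ∣ a`). [folklore] -/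
def invMod (p : ℕ) (a : ℤ) : ℤ := (a % (p : ℤ)) ^ (p - 2) % (p : ℤ)

/-- Chord–tangent addition on `y² = x³ + k` over `𝔽_p` (`a₁ = a₂ = a₃ = a₄ = 0`; tangent slope
`3x²/(2y)`); points as `Option (ℤ × ℤ)` with `none = O`, coordinates reduced mod `p`; inputs assumed on
the curve. [cite: SilvermanAEC2009, III.2.3] -/
def addModMordell (p : ℕ) : Option (ℤ × ℤ) → Option (ℤ × ℤ) → Option (ℤ × ℤ)
  | none, Q => Q
  | some P, none => some P
  | some (x₁, y₁), some (x₂, y₂) =>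
    if (x₁ - x₂) % (p : ℤ) = 0 then
      (if (y₁ + y₂) % (p : ℤ) = 0 then none
       else
        let L := 3 * x₁ * x₁ * invMod p (2 * y₁) % (p : ℤ)
        let x₃ := (L * L - x₁ - x₂) % (p : ℤ)
        some (x₃, (L * (x₁ - x₃) - y₁) % (p : ℤ)))
    else
      let L := (y₂ - y₁) * invMod p (x₂ - x₁) % (p : ℤ)
      let x₃ := (L * L - x₁ - x₂) % (p : ℤ)
      some (x₃, (L * (x₁ - x₃) - y₁) % (p : ℤ))

/-- `n·P` on `y² = x³ + k` over `𝔽_p` by repeated addition (`n` is small in every use). [folklore] -/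
def smulModMordell (p : ℕ) : ℕ → Option (ℤ × ℤ) → Option (ℤ × ℤ)
  | 0, _ => none
  | n + 1, P => addModMordell p (smulModMordell p n P) P

/-- Reduction mod `p` of the rational point `(X/d², Y/d³)` (`p ∤ d`): `(X·d̄⁻², Y·d̄⁻³)`. [folklore] -/
def reduceModGen (X Y : ℤ) (d p : ℕ) : ℤ × ℤ :=
  (X * invMod p (d : ℤ) ^ 2 % (p : ℤ), Y * invMod p (d : ℤ) ^ 3 % (p : ℤ))

/-! ### §2 The certificate -/

/-- **Certificate «`(X/d², Y/d³) ∉ 3·E_k(ℚ)`»** (module docstring): `p` prime, `p ≥ 5`, `p ∤ k`,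
`p ∤ d`, the reduced point is on the reduced curve, `3 ∣ n = #Ẽ_k(𝔽_p)`, and `(n/3)·Ḡ ≠ O`.
Meaning via [cite: SilvermanAEC2009, Prop. VII.2.1] (reduction is a homomorphism at good `p`). -/
def nonDivThreeCert (k X Y : ℤ) (d p : ℕ) : Bool :=
  isPrimeTD p && decide (5 ≤ p) && (k % (p : ℤ) != 0) && ((d : ℤ) % (p : ℤ) != 0) &&
  (cardModMordell k p % 3 == 0) &&
  (((reduceModGen X Y d p).2 ^ 2 - (reduceModGen X Y d p).1 ^ 3 - k) % (p : ℤ) == 0) &&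
  (smulModMordell p (cardModMordell k p / 3) (some (reduceModGen X Y d p))).isSome

/-- Unpacking the certificate. [folklore] -/
theorem nonDivThreeCert_iff (k X Y : ℤ) (d p : ℕ) :
    nonDivThreeCert k X Y d p = true ↔
      isPrimeTD p = true ∧ 5 ≤ p ∧ k % (p : ℤ) ≠ 0 ∧ (d : ℤ) % (p : ℤ) ≠ 0 ∧
      cardModMordell k p % 3 = 0 ∧
      ((reduceModGen X Y d p).2 ^ 2 - (reduceModGen X Y d p).1 ^ 3 - k) % (p : ℤ) = 0 ∧
      (smulModMordell p (cardModMordell k p / 3) (some (reduceModGen X Y d p))).isSome = true := by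
  simp only [nonDivThreeCert, Bool.and_eq_true, decide_eq_true_eq, bne_iff_ne, ne_eq, beq_iff_eq]
  tauto

/-- The group-theoretic step of the MEANING: in any additive commutative group in which `n` kills
every element and `3 ∣ n`, `(n/3)·(3h) = 0`; so a point `G = 3H` of `E(ℚ)` reduces to a point killed by
`n/3`, `n = #Ẽ(𝔽_p)` (Lagrange) — the certificate's last clause excludes this. [folklore] -/
theorem nsmul_div_three_of_three_nsmul {A : Type*} [AddCommGroup A] {n : ℕ} (hn : 3 ∣ n)
    (hA : ∀ a : A, n • a = 0) (h : A) : (n / 3) • (3 • h) = 0 := by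
  rw [← mul_nsmul', Nat.div_mul_cancel hn]
  exact hA h

/-! ### §3 The record and the display check -/

/-- One row per regime-V frame: class key, `k`, the member-1 generator `(X,Y,d)` and its certificate
prime `p`; `k'`, the member-2 generator and its prime `p'` (coordinates copied from the `VRow`). [folklore] -/
structure SatRow where
  cls : String
  k : ℤ
  gX : ℤ
  gY : ℤ
  gd : ℕ
  p : ℕ
  k' : ℤ
  tgX : ℤ
  tgY : ℤ
  tgd : ℕ
  p' : ℕ

namespace SatRow

/-- Both members' generators certified not `3`-divisible. [folklore] -/
def ok (r : SatRow) : Bool :=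
  nonDivThreeCert r.k r.gX r.gY r.gd r.p && nonDivThreeCert r.k' r.tgX r.tgY r.tgd r.p'

/-- The join with a V record: same class key, same `k`, `k'`, same generators. [folklore] -/
def matchesV (s : SatRow) (r : VRow) : Bool :=
  (s.cls == r.cls) && (s.k == r.k) && (s.gX == r.gX) && (s.gY == r.gY) && (s.gd == r.gd) &&
  (s.k' == r.k') && (s.tgX == r.tgX) && (s.tgY == r.tgY) && (s.tgd == r.tgd)

/-- `ok` unpacked. [folklore] -/
theorem ok_iff (r : SatRow) :
    r.ok = true ↔ nonDivThreeCert r.k r.gX r.gY r.gd r.p = true ∧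
      nonDivThreeCert r.k' r.tgX r.tgY r.tgd r.p' = true := by
  simp only [ok, Bool.and_eq_true]

end SatRow

/-- Display check: every row `ok` and the row count as stated. [folklore] -/
def satCheck (rs : List SatRow) (n : ℕ) : Bool :=
  rs.all SatRow.ok && (rs.length == n)

/-- Unpacking a display theorem per row. [folklore] -/
theorem SatRow.ok_of_satCheck {rs : List SatRow} {n : ℕ} (h : satCheck rs n = true) {r : SatRow}
    (hr : r ∈ rs) : r.ok = true := by
  simp only [satCheck, Bool.and_eq_true] at h
  exact List.all_eq_true.1 h.1 r hr

/-- The row count of a checked display. [folklore] -/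
theorem length_eq_of_satCheck {rs : List SatRow} {n : ℕ} (h : satCheck rs n = true) :
    rs.length = n := by
  simp only [satCheck, Bool.and_eq_true, beq_iff_eq] at h
  exact h.2

end Summit.BirchSwinnertonDyer.Rank1Residual.X12.CMRamifiedRecords
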